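import Literature.Analysis.PDE.CoordWordDeriv
import Mathlib.MeasureTheory.Function.L2Space
import Mathlib.MeasureTheory.Function.LpSpace.Basic
import Mathlib.Analysis.InnerProductSpace.Projection.Basic
import Mathlib.Analysis.Distribution.AEEqOfIntegralContDiff
import Mathlib.MeasureTheory.Measure.SeparableMeasure
import Mathlib.Data.Fintype.Vector
import Mathlib.Data.List.ReduceOption
import HarnessLib

/-!
# Full-space Sobolev tuple spaces `𝐇_s = ⊕_{k<N} H^s(ℝⁿ; W)` as closed subspaces of one `L²`

Function-space layer of the energy-method programme for short-time existence of quasilinear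
strictly parabolic second-order systems on a closed manifold (hypothesis `hQL` of
`Literature.Geometry.Riemannian.ricciFlow_shortTime_existence_of_quasilinear`; Hamilton 1982,
§5; Taylor, *PDE III*, Ch. 15, §7). A map `u : M → W` on a closed manifold covered by `N`
charts is localised to an `N`-tuple of compactly supported maps `ℝⁿ → W`; the Galerkin energy
method (Kato–Lai 1984, Thm. A, proved in the tree) is then run in the Hilbert spaces of this
file. Following Adams (*Sobolev Spaces*, ¶3.1–3.2: `W^{m,p}` normed by the sum of the `Lᵖ`
norms of all derivatives of order `≤ m`, and `H^{m,p}` = the closure of the smooth functions in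
that norm; `H = W`, Thm. 3.16, is not needed here) we realise

* `JetVal W N s = ⊕_{(k, w)} W` — the finite-dimensional Hilbert space of "jet values" indexed by
  a chart index `k < N` and an OPTION WORD `w` of length `s` (letters in `Option ι`, the letter
  `none` standing for "no derivative", so that words of length exactly `s` encode all coordinate
  derivatives of order `≤ s`, with harmless repetitions), and the single Lebesgue space
  `L2Jet W N s = L²(ℝⁿ; JetVal W N s)`;
* `jetFun s u x = (∂_w u_k (x))_{(k, w)}` for an `N`-tuple `u` of smooth compactly supported maps
  (`smoothCS`), the linear map `jetL s : smoothCS →ₗ L2Jet` and its range `smoothRange s`;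
* `Hs W N s` — **the Sobolev tuple space** `𝐇_s`, the topological closure of `smoothRange s`: a
  separable real Hilbert space (closed subspace of `L²`), with the `H^s` inner product
  `⟪jetL s u, jetL s v⟫ = Σ_k Σ_w ∫ ⟪∂_w u_k, ∂_w v_k⟫` (`inner_jetL_jetL`);
* the **weak-derivative identities** that survive in the closure: for `U ∈ 𝐇_s`, every
  component `U_{(k, w)}` is the weak `∂_w`-derivative of the bottom component `U_{(k, 0)}`
  (`integral_smul_comp_eq`), whence the **restriction maps** `Hs.restrict : 𝐇_{s+d} →L 𝐇_s`
  (forget the words that use the last `d` letters) are INJECTIVE with dense range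
  (`restrict_injective`, `denseRange_restrict`) — the inclusions `V ⊂ H` of the Galerkin triplet.

Everything is proved; no named fact and no `sorry` is introduced.

## References

* R. A. Adams, *Sobolev Spaces*, Academic Press 1975, ¶3.1–3.2 (the spaces `W^{m,p}`, `H^{m,p}`).
  [Adams1975]
* T. Kato, C. Y. Lai, Nonlinear evolution equations and the Euler flow, J. Funct. Anal. 56
  (1984) 15–28, §3 (admissible triplets `V ⊂ H ⊂ X`). [KatoLai1984]
-/

noncomputable section

open MeasureTheory Set Function Filter
open scoped ContDiff Topology RealInnerProductSpace ENNReal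

namespace Literature.Analysis.PDE

open Literature.Analysis.FunctionSpaces

variable {ι : Type*} [Fintype ι]

/-! ### Option words -/

/-- **Option words** of length `s`: words in the alphabet `Option ι`, the letter `none` meaning
"no derivative". [folklore] -/
abbrev OWord (ι : Type*) (s : ℕ) := List.Vector (Option ι) s

namespace OWord

variable {s : ℕ}

/-- The genuine word (in `ι`) underlying an option word: drop the `none` letters. [folklore] -/
def red (w : OWord ι s) : List ι := w.1.reduceOption

omit [Fintype ι] in
/-- The reduced word is not longer than the option word. [folklore] -/
theorem length_red_le (w : OWord ι s) : w.red.length ≤ s :=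
  (List.reduceOption_length_le w.1).trans_eq w.2

variable (ι s) in
/-- The trivial option word `none … none` (no derivative at all). [folklore] -/
def zero : OWord ι s := ⟨List.replicate s none, by simp⟩

omit [Fintype ι] in
/-- The trivial word reduces to the empty word. [folklore] -/
@[simp]
theorem red_zero : (zero ι s).red = [] := by
  simp [red, zero, List.reduceOption_replicate_none]

/-- **Padding** with `d` trailing `none`s: the embedding of words of length `s` into words of
length `s + d` along which the Sobolev spaces restrict. [folklore] -/
def pad (d : ℕ) (w : OWord ι s) : OWord ι (s + d) :=
  ⟨w.1 ++ List.replicate d none, by simp [w.2]⟩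

omit [Fintype ι] in
/-- Padding does not change the underlying genuine word. [folklore] -/
@[simp]
theorem red_pad (d : ℕ) (w : OWord ι s) : (w.pad d).red = w.red := by
  simp [red, pad, List.reduceOption_append, List.reduceOption_replicate_none]

omit [Fintype ι] in
/-- Padding is injective. [folklore] -/
theorem pad_injective (d : ℕ) : Function.Injective (pad (ι := ι) (s := s) d) := by
  intro w w' h
  have h1 : w.1 ++ List.replicate d none = w'.1 ++ List.replicate d none := congrArg Subtype.val h
  exact Subtype.ext (List.append_cancel_right h1)

omit [Fintype ι] in
/-- Padding the trivial word gives the trivial word. [folklore] -/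
@[simp]
theorem pad_zero (d : ℕ) : (zero ι s).pad d = zero ι (s + d) :=
  Subtype.ext (List.replicate_add s d none).symm

/-- Every genuine word of length `≤ s` is the reduction of an option word of length `s`
(append `none`s). [folklore] -/
def ofList (v : List ι) (hv : v.length ≤ s) : OWord ι s :=
  ⟨v.map some ++ List.replicate (s - v.length) none, by simp; omega⟩

omit [Fintype ι] in
/-- `(ofList v).red = v`. [folklore] -/
@[simp]
theorem red_ofList (v : List ι) (hv : v.length ≤ s) : (ofList v hv).red = v := by
  simp only [red, ofList, List.reduceOption_append, List.reduceOption_replicate_none,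
    List.append_nil]
  induction v with
  | nil => rfl
  | cons a v ih =>
    rw [List.map_cons, List.reduceOption_cons_of_some]
    congr 1
    exact ih (by simp at hv; omega)

end OWord

/-- **Option-word derivative** `owd w f = ∂_{red w} f`. [folklore] -/
def owd {F : Type*} [NormedAddCommGroup F] [NormedSpace ℝ F] {s : ℕ} (w : OWord ι s)
    (f : EuclideanSpace ℝ ι → F) : EuclideanSpace ℝ ι → F :=
  cwd w.red f

section OWD

variable {F : Type*} [NormedAddCommGroup F] [NormedSpace ℝ F] {s : ℕ}

/-- Unfolding. [folklore] -/
theorem owd_def (w : OWord ι s) (f : EuclideanSpace ℝ ι → F) : owd w f = cwd w.red f := rfl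

/-- The trivial word does not differentiate. [folklore] -/
@[simp]
theorem owd_zero (f : EuclideanSpace ℝ ι → F) : owd (OWord.zero ι s) f = f := by
  rw [owd_def, OWord.red_zero, cwd_nil]

/-- Padded words give the same derivative. [folklore] -/
@[simp]
theorem owd_pad (d : ℕ) (w : OWord ι s) (f : EuclideanSpace ℝ ι → F) :
    owd (w.pad d) f = owd w f := by
  rw [owd_def, owd_def, OWord.red_pad]

/-- `owd (ofList v) f = cwd v f`. [folklore] -/
@[simp]
theorem owd_ofList (v : List ι) (hv : v.length ≤ s) (f : EuclideanSpace ℝ ι → F) :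
    owd (OWord.ofList v hv) f = cwd v f := by
  rw [owd_def, OWord.red_ofList]

/-- Smoothness. [folklore] -/
theorem contDiff_owd {f : EuclideanSpace ℝ ι → F} (hf : ContDiff ℝ ∞ f) (w : OWord ι s) :
    ContDiff ℝ ∞ (owd w f) :=
  contDiff_cwd hf _

/-- Continuity. [folklore] -/
theorem continuous_owd {f : EuclideanSpace ℝ ι → F} (hf : ContDiff ℝ ∞ f) (w : OWord ι s) :
    Continuous (owd w f) :=
  continuous_cwd hf _

/-- Compact support. [folklore] -/
theorem hasCompactSupport_owd {f : EuclideanSpace ℝ ι → F} (hf : HasCompactSupport f)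
    (w : OWord ι s) : HasCompactSupport (owd w f) :=
  hasCompactSupport_cwd hf _

/-- Additivity. [folklore] -/
theorem owd_add {f g : EuclideanSpace ℝ ι → F} (hf : ContDiff ℝ ∞ f) (hg : ContDiff ℝ ∞ g)
    (w : OWord ι s) : owd w (f + g) = owd w f + owd w g :=
  cwd_add hf hg _

/-- Homogeneity. [folklore] -/
theorem owd_smul {f : EuclideanSpace ℝ ι → F} (hf : ContDiff ℝ ∞ f) (c : ℝ) (w : OWord ι s) :
    owd w (c • f) = c • owd w f :=
  cwd_const_smul hf c w.red

/-- `owd w 0 = 0`. [folklore] -/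
@[simp]
theorem owd_zero_fun (w : OWord ι s) : owd w (0 : EuclideanSpace ℝ ι → F) = 0 :=
  cwd_zero _

end OWD

/-! ### Jet values and the ambient `L²` space -/

/-- **Jet values**: the finite-dimensional Hilbert space `⊕_{(k, w)} W` indexed by a chart index
`k < N` and an option word of length `s`. [folklore] -/
abbrev JetVal (W : Type*) [NormedAddCommGroup W] [InnerProductSpace ℝ W] (N s : ℕ) (ι : Type*)
    [Fintype ι] :=
  PiLp 2 (fun _ : Fin N × OWord ι s => W)

/-- **The ambient space** `L²(ℝⁿ; JetVal)`. [folklore] -/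
abbrev L2Jet (W : Type*) [NormedAddCommGroup W] [InnerProductSpace ℝ W] (N s : ℕ) (ι : Type*)
    [Fintype ι] :=
  Lp (JetVal W N s ι) 2 (volume : Measure (EuclideanSpace ℝ ι))

variable {W : Type*} [NormedAddCommGroup W] [InnerProductSpace ℝ W]
variable {N : ℕ}

/-- **Smooth compactly supported `N`-tuples** `u = (u_k)_{k<N}` of maps `ℝⁿ → W`, as a real
submodule of all tuples. [folklore] -/
def smoothCS (W : Type*) [NormedAddCommGroup W] [InnerProductSpace ℝ W] (N : ℕ) (ι : Type*)
    [Fintype ι] : Submodule ℝ (Fin N → EuclideanSpace ℝ ι → W) where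
  carrier := {u | ∀ k, ContDiff ℝ ∞ (u k) ∧ HasCompactSupport (u k)}
  add_mem' := by
    intro u v hu hv k
    exact ⟨(hu k).1.add (hv k).1, (hu k).2.add (hv k).2⟩
  zero_mem' := by
    intro k
    simp only [Pi.zero_apply]
    exact ⟨contDiff_const, HasCompactSupport.zero⟩
  smul_mem' := by
    intro c u hu k
    refine ⟨(hu k).1.const_smul c, (hu k).2.mono fun x hx h0 => hx ?_⟩
    change c • u k x = 0
    rw [h0, smul_zero]

/-- Membership in `smoothCS`. [folklore] -/
theorem mem_smoothCS {u : Fin N → EuclideanSpace ℝ ι → W} :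
    u ∈ smoothCS W N ι ↔ ∀ k, ContDiff ℝ ∞ (u k) ∧ HasCompactSupport (u k) := Iff.rfl

variable {s : ℕ}

/-- **The jet map** `jetFun s u x = (∂_w u_k (x))_{(k, w)}`. [folklore] -/
def jetFun (s : ℕ) (u : Fin N → EuclideanSpace ℝ ι → W) (x : EuclideanSpace ℝ ι) :
    JetVal W N s ι :=
  WithLp.toLp 2 fun p : Fin N × OWord ι s => owd p.2 (u p.1) x

/-- Components of the jet map. [folklore] -/
@[simp]
theorem jetFun_apply (s : ℕ) (u : Fin N → EuclideanSpace ℝ ι → W) (x : EuclideanSpace ℝ ι)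
    (p : Fin N × OWord ι s) : jetFun s u x p = owd p.2 (u p.1) x := rfl

/-- The jet map of a smooth tuple is continuous. [folklore] -/
theorem continuous_jetFun {u : Fin N → EuclideanSpace ℝ ι → W} (hu : u ∈ smoothCS W N ι) :
    Continuous (jetFun s u) := by
  have h : Continuous fun x => fun p : Fin N × OWord ι s => owd p.2 (u p.1) x :=
    continuous_pi fun p => continuous_owd (hu p.1).1 p.2
  exact (PiLp.continuousLinearEquiv 2 ℝ (fun _ : Fin N × OWord ι s => W)).symm.continuous.comp h

/-- The jet map of a smooth compactly supported tuple has compact support. [folklore] -/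
theorem hasCompactSupport_jetFun {u : Fin N → EuclideanSpace ℝ ι → W}
    (hu : u ∈ smoothCS W N ι) : HasCompactSupport (jetFun s u) := by
  classical
  -- the support lies in the union of the supports of the `u_k`
  have hK : IsCompact (⋃ k : Fin N, tsupport (u k)) := isCompact_iUnion fun k => (hu k).2
  refine HasCompactSupport.of_support_subset_isCompact hK ?_
  intro x hx
  rw [mem_support] at hx
  by_contra hx'
  apply hx
  have hzero : ∀ p : Fin N × OWord ι s, owd p.2 (u p.1) x = 0 := by
    intro p
    have hp : x ∉ tsupport (u p.1) := fun h => hx' (mem_iUnion.2 ⟨p.1, h⟩)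
    have hsub := tsupport_cwd_subset (F := W) p.2.red (u p.1)
    exact image_eq_zero_of_notMem_tsupport fun h => hp (hsub h)
  ext p
  simp [jetFun, hzero p]

/-- The jet map of a smooth compactly supported tuple is in `L²`. [folklore] -/
theorem memLp_jetFun {u : Fin N → EuclideanSpace ℝ ι → W} (hu : u ∈ smoothCS W N ι) :
    MemLp (jetFun s u) 2 (volume : Measure (EuclideanSpace ℝ ι)) :=
  (continuous_jetFun hu).memLp_of_hasCompactSupport (hasCompactSupport_jetFun hu)

/-- The jet map is additive on smooth tuples. [folklore] -/
theorem jetFun_add {u v : Fin N → EuclideanSpace ℝ ι → W} (hu : u ∈ smoothCS W N ι)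
    (hv : v ∈ smoothCS W N ι) : jetFun s (u + v) = jetFun s u + jetFun s v := by
  funext x
  ext p
  simp only [jetFun_apply, Pi.add_apply, PiLp.add_apply]
  rw [owd_add (hu p.1).1 (hv p.1).1]
  rfl

/-- The jet map is homogeneous on smooth tuples. [folklore] -/
theorem jetFun_smul {u : Fin N → EuclideanSpace ℝ ι → W} (hu : u ∈ smoothCS W N ι) (c : ℝ) :
    jetFun s (c • u) = c • jetFun s u := by
  funext x
  ext p
  simp only [jetFun_apply, Pi.smul_apply, PiLp.smul_apply]
  rw [owd_smul (hu p.1).1 c]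
  rfl

variable (s) in
/-- **The jet map as a linear map into `L²`**: `jetL s u = [jetFun s u] ∈ L²(ℝⁿ; JetVal)`.
[folklore] -/
def jetL : smoothCS W N ι →ₗ[ℝ] L2Jet W N s ι where
  toFun u := (memLp_jetFun (s := s) u.2).toLp (jetFun s u)
  map_add' u v := by
    have h := MemLp.toLp_add (memLp_jetFun (s := s) u.2) (memLp_jetFun (s := s) v.2)
    rw [← h]
    congr 1
    exact jetFun_add u.2 v.2
  map_smul' c u := by
    have h := MemLp.toLp_const_smul c (memLp_jetFun (s := s) u.2)
    rw [RingHom.id_apply, ← h]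
    congr 1
    exact jetFun_smul u.2 c

/-- The `L²` class `jetL s u` is represented by the function `jetFun s u`. [folklore] -/
theorem coeFn_jetL (u : smoothCS W N ι) :
    (jetL s u : EuclideanSpace ℝ ι → JetVal W N s ι) =ᵐ[volume] jetFun s u :=
  MemLp.coeFn_toLp (memLp_jetFun (s := s) u.2)

/-- The range of the jet map: the smooth compactly supported elements of `L²(ℝⁿ; JetVal)`.
[folklore] -/
def smoothRange (W : Type*) [NormedAddCommGroup W] [InnerProductSpace ℝ W] (N s : ℕ) (ι : Type*)
    [Fintype ι] : Submodule ℝ (L2Jet W N s ι) :=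
  LinearMap.range (jetL (W := W) (N := N) (ι := ι) s)

/-- **The Sobolev tuple space** `𝐇_s = ⊕_{k<N} H^s(ℝⁿ; W)`: the closure in `L²(ℝⁿ; JetVal)` of the
jets of smooth compactly supported tuples (Adams, ¶3.1, the space `H^{m,2} = W₀^{m,2}(ℝⁿ)`).
[cite: Adams1975, ¶3.1] -/
def Hs (W : Type*) [NormedAddCommGroup W] [InnerProductSpace ℝ W] (N s : ℕ) (ι : Type*)
    [Fintype ι] : Submodule ℝ (L2Jet W N s ι) :=
  (smoothRange W N s ι).topologicalClosure

/-- `smoothRange ≤ Hs`. [folklore] -/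
theorem smoothRange_le_Hs : smoothRange W N s ι ≤ Hs W N s ι :=
  Submodule.le_topologicalClosure _

/-- `Hs` is closed in `L²`. [folklore] -/
theorem isClosed_Hs : IsClosed (Hs W N s ι : Set (L2Jet W N s ι)) :=
  Submodule.isClosed_topologicalClosure _

/-- `𝐇_s` is complete (a closed subspace of `L²`). [folklore] -/
instance instCompleteSpaceHs [CompleteSpace W] : CompleteSpace (Hs W N s ι) :=
  isClosed_Hs.completeSpace_coe

/-- `jetL s u ∈ Hs`. [folklore] -/
theorem jetL_mem_Hs (u : smoothCS W N ι) : jetL s u ∈ Hs W N s ι :=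
  smoothRange_le_Hs ⟨u, rfl⟩

variable (s) in
/-- The jet map with values in `𝐇_s`. [folklore] -/
def jetH (u : smoothCS W N ι) : Hs W N s ι := ⟨jetL s u, jetL_mem_Hs u⟩

/-- Coercion of `jetH`. [folklore] -/
@[simp]
theorem coe_jetH (u : smoothCS W N ι) : (jetH s u : L2Jet W N s ι) = jetL s u := rfl

/-- The carrier of `𝐇_s` is the closure of `smoothRange`. [folklore] -/
theorem coe_Hs : (Hs W N s ι : Set (L2Jet W N s ι)) = closure (smoothRange W N s ι) :=
  Submodule.topologicalClosure_coe _

/-- **Density of smooth jets in `𝐇_s`** (by construction). [folklore] -/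
theorem denseRange_jetH : DenseRange (jetH (W := W) (N := N) (ι := ι) s) := by
  have hr : range (jetH (W := W) (N := N) (ι := ι) s) =
      ((↑) : Hs W N s ι → L2Jet W N s ι) ⁻¹' (smoothRange W N s ι : Set (L2Jet W N s ι)) := by
    ext ⟨y, hy⟩
    constructor
    · rintro ⟨u, hu⟩
      rw [← hu]
      exact ⟨u, rfl⟩
    · rintro ⟨u, hu⟩
      exact ⟨u, Subtype.ext hu⟩
  rw [DenseRange, hr, Subtype.dense_iff]
  intro y hy
  have hy' : y ∈ closure (smoothRange W N s ι : Set (L2Jet W N s ι)) := by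
    rw [← coe_Hs]; exact hy
  have hsub : (smoothRange W N s ι : Set (L2Jet W N s ι)) ⊆
      ((↑) : Hs W N s ι → L2Jet W N s ι) '' (((↑) : Hs W N s ι → L2Jet W N s ι) ⁻¹'
        (smoothRange W N s ι : Set (L2Jet W N s ι))) := fun z hz =>
    ⟨⟨z, smoothRange_le_Hs hz⟩, hz, rfl⟩
  exact closure_mono hsub hy'

/-- **Closure induction for `𝐇_s`**: a property closed in `L²` that holds on smooth jets holds on
`𝐇_s`. [folklore] -/
theorem Hs_induction {P : L2Jet W N s ι → Prop} (hP : IsClosed {U | P U})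
    (hsmooth : ∀ u : smoothCS W N ι, P (jetL s u)) {U : L2Jet W N s ι} (hU : U ∈ Hs W N s ι) :
    P U := by
  have hU' : U ∈ closure (smoothRange W N s ι : Set (L2Jet W N s ι)) := by
    rw [← coe_Hs]; exact hU
  have hsub : (smoothRange W N s ι : Set (L2Jet W N s ι)) ⊆ {U | P U} := by
    intro V hV
    obtain ⟨u, rfl⟩ := hV
    exact hsmooth u
  exact hP.closure_subset_iff.2 hsub hU'

/-! ### The `H^s` inner product on smooth jets -/

/-- Integrability of the pointwise inner products of word derivatives of smooth compactly
supported tuples. [folklore] -/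
theorem integrable_inner_owd {u v : Fin N → EuclideanSpace ℝ ι → W} (hu : u ∈ smoothCS W N ι)
    (hv : v ∈ smoothCS W N ι) (k : Fin N) (w w' : OWord ι s) :
    Integrable (fun x => ⟪owd w (u k) x, owd w' (v k) x⟫)
      (volume : Measure (EuclideanSpace ℝ ι)) :=
  integrable_inner_of_hasCompactSupport (continuous_owd (hu k).1 w) (continuous_owd (hv k).1 w')
    (Or.inl (hasCompactSupport_owd (hu k).2 w))

/-- **The `H^s` inner product**: `⟪jetL s u, jetL s v⟫ = Σ_{(k,w)} ∫ ⟪∂_w u_k, ∂_w v_k⟫`.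
[cite: Adams1975, ¶3.1] -/
theorem inner_jetL_jetL (u v : smoothCS W N ι) :
    ⟪jetL s u, jetL s v⟫ = ∑ p : Fin N × OWord ι s, ∫ x, ⟪owd p.2 (u.1 p.1) x, owd p.2 (v.1 p.1) x⟫ := by
  rw [L2.inner_def]
  have h1 : (fun x => ⟪(jetL s u : EuclideanSpace ℝ ι → JetVal W N s ι) x,
      (jetL s v : EuclideanSpace ℝ ι → JetVal W N s ι) x⟫) =ᵐ[volume]
      fun x => ∑ p : Fin N × OWord ι s, ⟪owd p.2 (u.1 p.1) x, owd p.2 (v.1 p.1) x⟫ := by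
    filter_upwards [coeFn_jetL (s := s) u, coeFn_jetL (s := s) v] with x hux hvx
    rw [hux, hvx, PiLp.inner_apply]
    rfl
  rw [integral_congr_ae h1, integral_finsetSum]
  exact fun p _ => integrable_inner_owd u.2 v.2 p.1 p.2 p.2

/-- **The `H^s` norm**: `‖jetL s u‖² = Σ_{(k,w)} ∫ ‖∂_w u_k‖²`. [cite: Adams1975, ¶3.1] -/
theorem norm_jetL_sq (u : smoothCS W N ι) :
    ‖jetL s u‖ ^ 2 = ∑ p : Fin N × OWord ι s, ∫ x, ‖owd p.2 (u.1 p.1) x‖ ^ 2 := by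
  rw [← real_inner_self_eq_norm_sq, inner_jetL_jetL]
  refine Finset.sum_congr rfl fun p _ => integral_congr_ae (Eventually.of_forall fun x => ?_)
  exact real_inner_self_eq_norm_sq _

/-- Each summand of the `H^s` norm is nonnegative. [folklore] -/
theorem integral_norm_owd_sq_nonneg (u : Fin N → EuclideanSpace ℝ ι → W) (p : Fin N × OWord ι s) :
    0 ≤ ∫ x, ‖owd p.2 (u p.1) x‖ ^ 2 ∂(volume : Measure (EuclideanSpace ℝ ι)) :=
  integral_nonneg fun x => by positivity

/-- **A single word derivative is controlled by the `H^s` norm**: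
`∫ ‖∂_v u_k‖² ≤ ‖jetL s u‖²` for `|v| ≤ s`. [cite: Adams1975, ¶3.1] -/
theorem integral_norm_cwd_sq_le (u : smoothCS W N ι) (k : Fin N) {v : List ι}
    (hv : v.length ≤ s) :
    ∫ x, ‖cwd v (u.1 k) x‖ ^ 2 ∂(volume : Measure (EuclideanSpace ℝ ι)) ≤ ‖jetL s u‖ ^ 2 := by
  rw [norm_jetL_sq]
  have h := Finset.single_le_sum (f := fun p : Fin N × OWord ι s => ∫ x, ‖owd p.2 (u.1 p.1) x‖ ^ 2)
    (fun p _ => integral_norm_owd_sq_nonneg u.1 p) (Finset.mem_univ (k, OWord.ofList v hv))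
  simpa only [owd_ofList] using h

/-- `L²` form of the previous bound: `‖∂_v u_k‖_{L²} ≤ ‖jetL s u‖` for `|v| ≤ s`.
[cite: Adams1975, ¶3.1] -/
theorem eLpNorm_cwd_le (u : smoothCS W N ι) (k : Fin N) {v : List ι} (hv : v.length ≤ s) :
    (eLpNorm (cwd v (u.1 k)) 2 (volume : Measure (EuclideanSpace ℝ ι))).toReal ≤ ‖jetL s u‖ := by
  have hmem : MemLp (cwd v (u.1 k)) 2 (volume : Measure (EuclideanSpace ℝ ι)) :=
    (continuous_cwd (u.2 k).1 v).memLp_of_hasCompactSupport (hasCompactSupport_cwd (u.2 k).2 v)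
  have h1 : (eLpNorm (cwd v (u.1 k)) 2 (volume : Measure (EuclideanSpace ℝ ι))).toReal ^ 2 =
      ∫ x, ‖cwd v (u.1 k) x‖ ^ 2 := by
    rw [← Lp.norm_toLp (cwd v (u.1 k)) hmem, ← real_inner_self_eq_norm_sq, L2.inner_def]
    refine integral_congr_ae ?_
    filter_upwards [hmem.coeFn_toLp] with x hx
    rw [hx, real_inner_self_eq_norm_sq]
  have h2 := integral_norm_cwd_sq_le u k hv
  rw [← h1] at h2
  have h3 := sq_le_sq.1 h2
  rwa [abs_of_nonneg ENNReal.toReal_nonneg, abs_of_nonneg (norm_nonneg _)] at h3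

/-! ### Slots: testing one component -/

section Slot

variable [DecidableEq ι]

/-- The jet value with `y` in slot `p` and `0` elsewhere. [folklore] -/
def slotVal (p : Fin N × OWord ι s) (y : W) : JetVal W N s ι :=
  WithLp.toLp 2 fun q => if q = p then y else 0

/-- Components of `slotVal`. [folklore] -/
@[simp]
theorem slotVal_apply (p q : Fin N × OWord ι s) (y : W) :
    slotVal p y q = if q = p then y else 0 := rfl

/-- `⟪slotVal p y, t⟫ = ⟪y, t p⟫`. [folklore] -/
theorem inner_slotVal_left (p : Fin N × OWord ι s) (y : W) (t : JetVal W N s ι) :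
    ⟪slotVal p y, t⟫ = ⟪y, t p⟫ := by
  rw [PiLp.inner_apply]
  simp only [slotVal_apply]
  rw [Finset.sum_eq_single p]
  · simp
  · intro q _ hq
    simp [hq]
  · intro h; exact absurd (Finset.mem_univ p) h

/-- `slotVal` is linear in `y`: additivity. [folklore] -/
theorem slotVal_add (p : Fin N × OWord ι s) (y y' : W) :
    slotVal p (y + y') = slotVal p y + slotVal p y' := by
  ext q
  simp only [slotVal_apply, PiLp.add_apply]
  split_ifs <;> simp

/-- `slotVal p 0 = 0`. [folklore] -/
@[simp]
theorem slotVal_zero (p : Fin N × OWord ι s) : slotVal (W := W) p 0 = 0 := by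
  ext q
  simp

/-- Norm of a slot value. [folklore] -/
theorem norm_slotVal (p : Fin N × OWord ι s) (y : W) : ‖slotVal p y‖ = ‖y‖ := by
  have h : ‖slotVal p y‖ ^ 2 = ‖y‖ ^ 2 := by
    rw [← real_inner_self_eq_norm_sq, inner_slotVal_left, slotVal_apply, if_pos rfl,
      real_inner_self_eq_norm_sq]
  exact (sq_eq_sq₀ (norm_nonneg _) (norm_nonneg _)).1 h

/-- The `W`-valued test field `φ` placed in slot `p`: `x ↦ slotVal p (φ x)`. [folklore] -/
def slotFun (p : Fin N × OWord ι s) (φ : EuclideanSpace ℝ ι → W) (x : EuclideanSpace ℝ ι) :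
    JetVal W N s ι :=
  slotVal p (φ x)

/-- A slot field of a continuous compactly supported `φ` is in `L²`. [folklore] -/
theorem memLp_slotFun (p : Fin N × OWord ι s) {φ : EuclideanSpace ℝ ι → W} (hφ : Continuous φ)
    (hφc : HasCompactSupport φ) : MemLp (slotFun p φ) 2 (volume : Measure (EuclideanSpace ℝ ι)) := by
  have hc : Continuous (slotFun p φ) := by
    have h : Continuous fun x => fun q : Fin N × OWord ι s => if q = p then φ x else (0 : W) :=
      continuous_pi fun q => by split_ifs <;> fun_prop
    exact (PiLp.continuousLinearEquiv 2 ℝ (fun _ : Fin N × OWord ι s => W)).symm.continuous.comp h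
  refine hc.memLp_of_hasCompactSupport ?_
  refine hφc.mono ?_
  intro x hx
  rw [mem_support] at hx ⊢
  intro h0
  apply hx
  ext q
  simp [slotFun, h0]

/-- The `L²` class of a slot field. [folklore] -/
def slotLp (p : Fin N × OWord ι s) {φ : EuclideanSpace ℝ ι → W} (hφ : Continuous φ)
    (hφc : HasCompactSupport φ) : L2Jet W N s ι :=
  (memLp_slotFun p hφ hφc).toLp (slotFun p φ)

/-- **Testing a component**: `⟪slotLp p φ, U⟫ = ∫ ⟪φ, U_p⟫`. [folklore] -/
theorem inner_slotLp (p : Fin N × OWord ι s) {φ : EuclideanSpace ℝ ι → W} (hφ : Continuous φ)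
    (hφc : HasCompactSupport φ) (U : L2Jet W N s ι) :
    ⟪slotLp p hφ hφc, U⟫ = ∫ x, ⟪φ x, (U : EuclideanSpace ℝ ι → JetVal W N s ι) x p⟫ := by
  rw [L2.inner_def]
  refine integral_congr_ae ?_
  filter_upwards [(memLp_slotFun p hφ hφc).coeFn_toLp] with x hx
  rw [slotLp, hx, slotFun, inner_slotVal_left]

omit [DecidableEq ι] in
/-- Moving a word derivative across the pairing with a smooth compactly supported test field:
`∫ ⟪φ, ∂_v g⟫ = (-1)^{|v|} ∫ ⟪∂_v φ, g⟫`. [folklore] -/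
theorem integral_inner_cwd_right {φ g : EuclideanSpace ℝ ι → W} (hφ : ContDiff ℝ ∞ φ)
    (hφc : HasCompactSupport φ) (hg : ContDiff ℝ ∞ g) (v : List ι) :
    ∫ x, ⟪φ x, cwd v g x⟫ = (-1) ^ v.length * ∫ x, ⟪cwd v φ x, g x⟫ := by
  rw [integral_inner_cwd_eq hφ hg (Or.inl hφc) v, ← mul_assoc, ← pow_add, ← two_mul, pow_mul]
  simp

/-- **Components of a smooth jet are derivatives of the bottom component, tested**:
`⟪slot_{(k,w)} φ, jetL u⟫ = (-1)^{|red w|} ⟪slot_{(k,0)} (∂_w φ), jetL u⟫`. [cite: Adams1975, ¶1.57] -/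
theorem inner_slotLp_jetL (k : Fin N) (w : OWord ι s) {φ : EuclideanSpace ℝ ι → W}
    (hφ : ContDiff ℝ ∞ φ) (hφc : HasCompactSupport φ) (u : smoothCS W N ι) :
    ⟪slotLp (k, w) hφ.continuous hφc, jetL s u⟫ =
      (-1) ^ w.red.length * ⟪slotLp (k, OWord.zero ι s) (continuous_owd hφ w)
        (hasCompactSupport_owd hφc w), jetL s u⟫ := by
  rw [inner_slotLp, inner_slotLp]
  have h1 : (fun x => ⟪φ x, (jetL s u : EuclideanSpace ℝ ι → JetVal W N s ι) x (k, w)⟫) =ᵐ[volume]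
      fun x => ⟪φ x, cwd w.red (u.1 k) x⟫ := by
    filter_upwards [coeFn_jetL (s := s) u] with x hx
    rw [hx]; rfl
  have h2 : (fun x => ⟪owd w φ x, (jetL s u : EuclideanSpace ℝ ι → JetVal W N s ι) x
      (k, OWord.zero ι s)⟫) =ᵐ[volume] fun x => ⟪cwd w.red φ x, u.1 k x⟫ := by
    filter_upwards [coeFn_jetL (s := s) u] with x hx
    rw [hx, jetFun_apply, owd_zero]; rfl
  rw [integral_congr_ae h1, integral_congr_ae h2]
  exact integral_inner_cwd_right hφ hφc (u.2 k).1 w.red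

/-- **Weak derivatives in `𝐇_s`**: for `U ∈ 𝐇_s` every component `U_{(k,w)}` is the weak
`∂_w`-derivative of the bottom component `U_{(k,0)}`, in tested form:
`∫ ⟪φ, U_{(k,w)}⟫ = (-1)^{|red w|} ∫ ⟪∂_w φ, U_{(k,0)}⟫` for every smooth compactly supported `φ`.
[cite: Adams1975, ¶3.1 with ¶1.57] -/
theorem integral_inner_comp_eq {U : L2Jet W N s ι} (hU : U ∈ Hs W N s ι) (k : Fin N) (w : OWord ι s)
    {φ : EuclideanSpace ℝ ι → W} (hφ : ContDiff ℝ ∞ φ) (hφc : HasCompactSupport φ) :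
    ∫ x, ⟪φ x, (U : EuclideanSpace ℝ ι → JetVal W N s ι) x (k, w)⟫ =
      (-1) ^ w.red.length *
        ∫ x, ⟪owd w φ x, (U : EuclideanSpace ℝ ι → JetVal W N s ι) x (k, OWord.zero ι s)⟫ := by
  rw [← inner_slotLp (k, w) hφ.continuous hφc,
    ← inner_slotLp (k, OWord.zero ι s) (continuous_owd hφ w) (hasCompactSupport_owd hφc w)]
  refine Hs_induction (P := fun U => ⟪slotLp (k, w) hφ.continuous hφc, U⟫ =
      (-1) ^ w.red.length * ⟪slotLp (k, OWord.zero ι s) (continuous_owd hφ w)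
        (hasCompactSupport_owd hφc w), U⟫) ?_ (fun u => inner_slotLp_jetL k w hφ hφc u) hU
  exact isClosed_eq (continuous_const.inner continuous_id)
    (continuous_const.mul (continuous_const.inner continuous_id))

omit [DecidableEq ι] in
/-- **A component of an `L²` jet vanishes a.e. if it is orthogonal to all test fields**.
[folklore] -/
theorem comp_ae_eq_zero_of_forall_test [CompleteSpace W] (U : L2Jet W N s ι)
    (p : Fin N × OWord ι s)
    (h : ∀ φ : EuclideanSpace ℝ ι → W, ContDiff ℝ ∞ φ → HasCompactSupport φ →
      ∫ x, ⟪φ x, (U : EuclideanSpace ℝ ι → JetVal W N s ι) x p⟫ = 0) :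
    ∀ᵐ x ∂(volume : Measure (EuclideanSpace ℝ ι)),
      (U : EuclideanSpace ℝ ι → JetVal W N s ι) x p = 0 := by
  have hfm : MemLp (fun x => (U : EuclideanSpace ℝ ι → JetVal W N s ι) x p) 2
      (volume : Measure (EuclideanSpace ℝ ι)) := by
    have h1 := Lp.memLp ((PiLp.proj 2 (𝕜 := ℝ) (fun _ : Fin N × OWord ι s => W) p).compLp U)
    refine h1.ae_eq ?_
    filter_upwards [ContinuousLinearMap.coeFn_compLp
      (PiLp.proj 2 (𝕜 := ℝ) (fun _ : Fin N × OWord ι s => W) p) U] with x hx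
    rw [hx, PiLp.proj_apply]
  have hli : LocallyIntegrable (fun x => (U : EuclideanSpace ℝ ι → JetVal W N s ι) x p)
      (volume : Measure (EuclideanSpace ℝ ι)) :=
    hfm.locallyIntegrable one_le_two
  refine ae_eq_zero_of_integral_contDiff_smul_eq_zero hli fun g hg hgc => ?_
  rw [← inner_self_eq_zero (𝕜 := ℝ)]
  have hint : Integrable (fun x => g x • (U : EuclideanSpace ℝ ι → JetVal W N s ι) x p)
      (volume : Measure (EuclideanSpace ℝ ι)) :=
    hli.integrable_smul_left_of_hasCompactSupport hg.continuous hgc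
  rw [← integral_inner hint]
  have hc : HasCompactSupport (fun x => g x •
      ∫ y, g y • (U : EuclideanSpace ℝ ι → JetVal W N s ι) y p) :=
    hgc.smul_right (f' := fun _ => ∫ y, g y • (U : EuclideanSpace ℝ ι → JetVal W N s ι) y p)
  have h0 := h _ (hg.smul contDiff_const) hc
  rw [← h0]
  refine integral_congr_ae (Eventually.of_forall fun x => ?_)
  change ⟪_, g x • _⟫ = ⟪g x • ∫ y, g y • (U : EuclideanSpace ℝ ι → JetVal W N s ι) y p, _⟫
  rw [real_inner_smul_left, real_inner_smul_right]

/-- **The `H^s` pairing of a smooth jet with an element of `𝐇_s`, all derivatives moved onto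
the smooth side**: `⟪jetL s v, U⟫ = Σ_{(k,w)} (-1)^{|red w|} ∫ ⟪∂_w ∂_w v_k, U_{(k,0)}⟫` — the identity
`(v, u)_{H^s} = ((1 - Δ)^s v, u)_{L²}` in word form. [cite: Adams1975, ¶3.1] -/
theorem inner_jetL_of_mem_Hs (v : smoothCS W N ι) {U : L2Jet W N s ι} (hU : U ∈ Hs W N s ι) :
    ⟪jetL s v, U⟫ = ∑ p : Fin N × OWord ι s, (-1) ^ p.2.red.length *
      ∫ x, ⟪owd p.2 (owd p.2 (v.1 p.1)) x,
        (U : EuclideanSpace ℝ ι → JetVal W N s ι) x (p.1, OWord.zero ι s)⟫ := by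
  have h1 : ⟪jetL s v, U⟫ = ∑ p : Fin N × OWord ι s,
      ∫ x, ⟪owd p.2 (v.1 p.1) x, (U : EuclideanSpace ℝ ι → JetVal W N s ι) x p⟫ := by
    have h2 : ∀ p : Fin N × OWord ι s,
        ⟪slotLp p (continuous_owd (v.2 p.1).1 p.2) (hasCompactSupport_owd (v.2 p.1).2 p.2), U⟫ =
          ∫ x, ⟪owd p.2 (v.1 p.1) x, (U : EuclideanSpace ℝ ι → JetVal W N s ι) x p⟫ :=
      fun p => inner_slotLp p _ _ U
    have h3 : jetL s v = ∑ p : Fin N × OWord ι s,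
        slotLp p (continuous_owd (v.2 p.1).1 p.2) (hasCompactSupport_owd (v.2 p.1).2 p.2) := by
      apply Lp.ext
      have h4 : ((∑ p : Fin N × OWord ι s, slotLp p (continuous_owd (v.2 p.1).1 p.2)
          (hasCompactSupport_owd (v.2 p.1).2 p.2) : L2Jet W N s ι) :
            EuclideanSpace ℝ ι → JetVal W N s ι) =ᵐ[volume]
          ∑ p : Fin N × OWord ι s, slotFun p (owd p.2 (v.1 p.1)) := by
        refine (Lp.coeFn_finsetSum _ _).trans ?_
        have h5 : ∀ p : Fin N × OWord ι s, ((slotLp p (continuous_owd (v.2 p.1).1 p.2)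
            (hasCompactSupport_owd (v.2 p.1).2 p.2) : L2Jet W N s ι) :
              EuclideanSpace ℝ ι → JetVal W N s ι) =ᵐ[volume] slotFun p (owd p.2 (v.1 p.1)) :=
          fun p => MemLp.coeFn_toLp _
        have h6 := (ae_all_iff (μ := (volume : Measure (EuclideanSpace ℝ ι)))).2 h5
        filter_upwards [h6] with x hx
        simp only [Finset.sum_apply]
        exact Finset.sum_congr rfl fun p _ => hx p
      refine (coeFn_jetL (s := s) v).trans (h4.trans (Eventually.of_forall fun x => ?_)).symm
      ext q
      simp only [Finset.sum_apply, jetFun_apply]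
      rw [show (∑ c : Fin N × OWord ι s, slotFun c (owd c.2 (v.1 c.1)) x) q =
          ∑ c : Fin N × OWord ι s, slotFun c (owd c.2 (v.1 c.1)) x q from by
        simp [WithLp.ofLp_sum]]
      simp only [slotFun, slotVal_apply]
      rw [Finset.sum_eq_single q]
      · simp
      · intro c _ hc; simp [Ne.symm hc]
      · intro h; exact absurd (Finset.mem_univ q) h
    rw [h3, sum_inner]
    exact Finset.sum_congr rfl fun p _ => h2 p
  rw [h1]
  refine Finset.sum_congr rfl fun p _ => ?_
  exact integral_inner_comp_eq hU p.1 p.2 (contDiff_owd (v.2 p.1).1 p.2)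
    (hasCompactSupport_owd (v.2 p.1).2 p.2)

end Slot

/-! ### Restriction maps `𝐇_{s+d} → 𝐇_s` -/

section Restrict

variable (d : ℕ)

/-- The restriction of jet values along padding: `(ρ t)_{(k,w)} = t_{(k, pad w)}`, as a linear
map. [folklore] -/
def restrictValₗ : JetVal W N (s + d) ι →ₗ[ℝ] JetVal W N s ι where
  toFun t := WithLp.toLp 2 fun p : Fin N × OWord ι s => t (p.1, p.2.pad d)
  map_add' t t' := by ext p; simp
  map_smul' c t := by ext p; simp

/-- Components of `restrictValₗ`. [folklore] -/
@[simp]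
theorem restrictValₗ_apply (t : JetVal W N (s + d) ι) (p : Fin N × OWord ι s) :
    restrictValₗ d t p = t (p.1, p.2.pad d) := rfl

/-- `‖restrictValₗ t‖ ≤ ‖t‖` (a sub-family of the components). [folklore] -/
theorem norm_restrictValₗ_le (t : JetVal W N (s + d) ι) : ‖restrictValₗ d t‖ ≤ ‖t‖ := by
  classical
  have h : ‖restrictValₗ d t‖ ^ 2 ≤ ‖t‖ ^ 2 := by
    rw [PiLp.norm_sq_eq_of_L2, PiLp.norm_sq_eq_of_L2]
    set e : Fin N × OWord ι s → Fin N × OWord ι (s + d) := fun p => (p.1, p.2.pad d) with he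
    have hinj : Function.Injective e := by
      intro p q hpq
      simp only [he, Prod.mk.injEq] at hpq
      exact Prod.ext hpq.1 (OWord.pad_injective d hpq.2)
    calc ∑ p : Fin N × OWord ι s, ‖restrictValₗ d t p‖ ^ 2
        = ∑ p : Fin N × OWord ι s, ‖t (e p)‖ ^ 2 := by simp [he]
      _ = ∑ q ∈ Finset.univ.image e, ‖t q‖ ^ 2 := by
          rw [Finset.sum_image fun p _ q _ h => hinj h]
      _ ≤ ∑ q, ‖t q‖ ^ 2 :=
          Finset.sum_le_sum_of_subset_of_nonneg (Finset.subset_univ _) fun q _ _ => by positivity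
  exact (sq_le_sq.1 (by simpa only [abs_of_nonneg (norm_nonneg _)] using h)) |> fun h' => by
    simpa only [abs_of_nonneg (norm_nonneg _)] using h'

/-- The restriction of jet values as a continuous linear map of norm `≤ 1`. [folklore] -/
def restrictVal : JetVal W N (s + d) ι →L[ℝ] JetVal W N s ι :=
  (restrictValₗ d).mkContinuous 1 fun t => by simpa using norm_restrictValₗ_le d t

/-- Components of `restrictVal`. [folklore] -/
@[simp]
theorem restrictVal_apply (t : JetVal W N (s + d) ι) (p : Fin N × OWord ι s) :
    restrictVal d t p = t (p.1, p.2.pad d) := rfl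

/-- Restriction of jets of smooth tuples: `ρ (jetFun (s+d) u x) = jetFun s u x`. [folklore] -/
theorem restrictVal_jetFun (u : Fin N → EuclideanSpace ℝ ι → W) (x : EuclideanSpace ℝ ι) :
    restrictVal d (jetFun (s + d) u x) = jetFun s u x := by
  ext p
  simp

/-- **The restriction map on `L²` jets** (post-composition with `restrictVal`). [folklore] -/
def restrictLp : L2Jet W N (s + d) ι →L[ℝ] L2Jet W N s ι :=
  ContinuousLinearMap.compLpL 2 (volume : Measure (EuclideanSpace ℝ ι)) (restrictVal d)

/-- Pointwise a.e. form of `restrictLp`. [folklore] -/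
theorem coeFn_restrictLp (U : L2Jet W N (s + d) ι) :
    (restrictLp d U : EuclideanSpace ℝ ι → JetVal W N s ι) =ᵐ[volume]
      fun x => restrictVal d ((U : EuclideanSpace ℝ ι → JetVal W N (s + d) ι) x) := by
  rw [restrictLp]
  exact ContinuousLinearMap.coeFn_compLpL _ _

/-- **Restriction of smooth jets**: `restrictLp (jetL (s+d) u) = jetL s u`. [folklore] -/
theorem restrictLp_jetL (u : smoothCS W N ι) : restrictLp d (jetL (s + d) u) = jetL s u := by
  apply Lp.ext
  refine (coeFn_restrictLp d _).trans ?_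
  filter_upwards [coeFn_jetL (s := s + d) u, coeFn_jetL (s := s) u] with x hx hx'
  rw [hx, hx', restrictVal_jetFun]

/-- `restrictLp` maps `𝐇_{s+d}` into `𝐇_s`. [folklore] -/
theorem restrictLp_mem_Hs {U : L2Jet W N (s + d) ι} (hU : U ∈ Hs W N (s + d) ι) :
    restrictLp d U ∈ Hs W N s ι := by
  refine Hs_induction (P := fun U => restrictLp d U ∈ Hs W N s ι) ?_ ?_ hU
  · exact isClosed_Hs.preimage (restrictLp d).continuous
  · intro u
    rw [restrictLp_jetL]
    exact jetL_mem_Hs u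

/-- **The restriction map `𝐇_{s+d} →L 𝐇_s`** (the inclusion `V ⊂ H` of the Galerkin triplet,
Kato–Lai 1984, §3). [cite: KatoLai1984, §3 (p. 18)] -/
def Hs.restrict : Hs W N (s + d) ι →L[ℝ] Hs W N s ι :=
  ((restrictLp d).comp (Hs W N (s + d) ι).subtypeL).codRestrict (Hs W N s ι) fun U =>
    restrictLp_mem_Hs d U.2

/-- Coercion of `Hs.restrict`. [folklore] -/
@[simp]
theorem coe_restrict (U : Hs W N (s + d) ι) :
    (Hs.restrict d U : L2Jet W N s ι) = restrictLp d U := rfl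

/-- `Hs.restrict (jetH (s+d) u) = jetH s u`. [folklore] -/
@[simp]
theorem restrict_jetH (u : smoothCS W N ι) : Hs.restrict d (jetH (s + d) u) = jetH s u :=
  Subtype.ext (restrictLp_jetL d u)

/-- **Dense range of the restriction map** (it contains all smooth jets).
[cite: KatoLai1984, §3 (p. 18)] -/
theorem denseRange_restrict : DenseRange (Hs.restrict (W := W) (N := N) (ι := ι) (s := s) d) := by
  refine (denseRange_jetH (W := W) (N := N) (ι := ι) (s := s)).mono ?_
  rintro _ ⟨u, rfl⟩
  exact ⟨jetH (s + d) u, restrict_jetH d u⟩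

variable [DecidableEq ι] [CompleteSpace W]

/-- **Injectivity of the restriction map**: an element of `𝐇_{s+d}` whose words of length `≤ s`
all vanish is zero — its remaining components are weak derivatives of the (vanishing) bottom
component. [cite: Adams1975, ¶3.1 with ¶1.57] -/
theorem restrict_injective :
    Function.Injective (Hs.restrict (W := W) (N := N) (ι := ι) (s := s) d) := by
  refine (injective_iff_map_eq_zero _).2 fun U hU => ?_
  have hU0 : restrictLp d (U : L2Jet W N (s + d) ι) = 0 := by
    have := congrArg (fun V : Hs W N s ι => (V : L2Jet W N s ι)) hU
    simpa using this
  -- the bottom components vanish a.e.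
  have hbot : ∀ k : Fin N, ∀ᵐ x ∂(volume : Measure (EuclideanSpace ℝ ι)),
      ((U : L2Jet W N (s + d) ι) : EuclideanSpace ℝ ι → JetVal W N (s + d) ι) x
        (k, OWord.zero ι (s + d)) = 0 := by
    intro k
    have h0 : ((0 : L2Jet W N s ι) : EuclideanSpace ℝ ι → JetVal W N s ι) =ᵐ[volume] 0 :=
      Lp.coeFn_zero _ _ _
    filter_upwards [coeFn_restrictLp d (U : L2Jet W N (s + d) ι), h0] with x hx hx0
    have h1 : (restrictLp d (U : L2Jet W N (s + d) ι) : EuclideanSpace ℝ ι → JetVal W N s ι) x =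
        ((0 : L2Jet W N s ι) : EuclideanSpace ℝ ι → JetVal W N s ι) x := by rw [hU0]
    rw [hx, hx0] at h1
    have h2 := congrArg (fun t : JetVal W N s ι => t (k, OWord.zero ι s)) h1
    simpa [OWord.pad_zero] using h2
  -- hence all components vanish a.e.
  have hall : ∀ p : Fin N × OWord ι (s + d), ∀ᵐ x ∂(volume : Measure (EuclideanSpace ℝ ι)),
      ((U : L2Jet W N (s + d) ι) : EuclideanSpace ℝ ι → JetVal W N (s + d) ι) x p = 0 := by
    intro p
    refine comp_ae_eq_zero_of_forall_test _ p fun φ hφ hφc => ?_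
    rw [show p = (p.1, p.2) from rfl, integral_inner_comp_eq U.2 p.1 p.2 hφ hφc]
    have hz : (fun x => ⟪owd p.2 φ x, ((U : L2Jet W N (s + d) ι) :
        EuclideanSpace ℝ ι → JetVal W N (s + d) ι) x (p.1, OWord.zero ι (s + d))⟫) =ᵐ[volume]
          fun _ => (0 : ℝ) := by
      filter_upwards [hbot p.1] with x hx
      rw [hx, inner_zero_right]
    rw [integral_congr_ae hz, integral_zero, mul_zero]
  have hae := (ae_all_iff (μ := (volume : Measure (EuclideanSpace ℝ ι)))).2 hall
  apply Subtype.ext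
  apply Lp.ext
  have h0 : ((0 : L2Jet W N (s + d) ι) : EuclideanSpace ℝ ι → JetVal W N (s + d) ι) =ᵐ[volume] 0 :=
    Lp.coeFn_zero _ _ _
  filter_upwards [hae, h0] with x hx hx0
  rw [Submodule.coe_zero, hx0]
  ext p
  simpa using hx p

end Restrict

/-! ### Separability -/

/-- `𝐇_s` is separable (a subspace of the separable space `L²(ℝⁿ; JetVal)`). [folklore] -/
instance instSeparableSpaceHs [SecondCountableTopology W] :
    TopologicalSpace.SeparableSpace (Hs W N s ι) := by
  haveI : Fact ((2 : ℝ≥0∞) ≠ ⊤) := ⟨ENNReal.ofNat_ne_top⟩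
  haveI : SecondCountableTopology (L2Jet W N s ι) := Lp.SecondCountableTopology
  infer_instance


end Literature.Analysis.PDE

end
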